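import Mathlib
import Summits.QuantumFields.YangMills.Theorems.FemtoTransferGapPositivityGram
import HarnessLib

/-!
# The TWISTED model kernel `K^tw(x,y) = ∫ K(x, T_g y) dθ(g)`: untwisting on invariant test functions, slot-wise invariance, symmetry
# (rate twin of `stub_boRate`, crux K1 `NearFlatRatioLaw` stmt-QuantumFields-24720, line «borate» — the repair of the instantiation map forced by the crux
# disprover's R32/R33 on `TwistedTraceScaling` 20203)

WHY.  The rate-twin toolkit (`Cruxes/NearFlatRatioLaw/Lines/borate-rate-toolkit-g7.md`) compares the gauge-averaged kernel `K̃_β = avgKernel` on lane A's tube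
`(u, w)` with the c-FROZEN FIBRED MODEL `K₁((u,w),(u',w')) = k(u,u')·m_u(w)G(w,w')m_{u'}(w')` (`…FibredBOKernel`) through a POINTWISE nearness hypothesis
`|K̃ − K₁(1+A)| ≤ ηK₁` (`KernelParity.abs_form_sub_le_of_kernel_near_odd`).  The crux disprover's R32/R33 (`Theorems/TwistedTraceScaling/Negative/AvgKernelNoLabSlowFactor.lean`,
`…AvgKernelStiffFlip.lean`, 2026-08-28) show that NO untwisted product «slow factor × stiff factor» is pointwise close to `K̃_β` near the abelian slow locus: `K̃_β` is invariant
under the residual CONSTANT gauge group `(u, w) ↦ (Ad_g u, R_g w)` in EACH slot separately, an untwisted product is not (stiff flip `w ↦ −w` at abelian `u`: `K̃` flat, the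
model pays `e^{−4βΣ|v_e|²}`).  The model that can be pointwise close to `K̃_β` is the TWISTED product `K^tw(x, y) = ∫_{SU(2)} K₁(x, g·y) dg`.  This file supplies the
abstract bookkeeping showing the repair costs the model side NOTHING: on test functions invariant under the action — which the tube images of gauge-invariant `ψ` are —
the forms (and rows) of `K^tw` and `K₁` coincide, so every FibredBO estimate (DIAG/STIFF/CROSS/FLOOR, computed for the untwisted `K₁`) is an estimate for `K^tw`, while
the true-vs-model transfer (`KernelParity`) is run between the two slot-wise invariant kernels `K̃_β` and `K^tw`.

Setting (def-free): a probability measure `θ` on an index type `G` (Haar of `SU(2)`), a finite measure `μ` on `X` (tube domain, `σ^{⊗3} ⊗ π`), a jointly measurable family of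
maps `T : G → X → X` each preserving `μ` (the diagonal constant-gauge action: conjugation on `σ^{⊗3}`, colour rotation on `π` — `orthoTransverse_map_colourRotate`), a bounded
jointly measurable kernel `K`.  The twisted kernel is always written out as `fun x y => ∫ g, K x (T g y) ∂θ`.
* §1 `measurable_twist`, `twist_nonneg`, `twist_le` — measurability and the pointwise bounds of `K` pass to the twist.
* §2 ★★ `integral_twist_mul_eq` — UNTWISTING: `∫ K^tw(x,y)Ψ(y) dμ(y) = ∫ K(x,y)Ψ(y) dμ(y)` for `T`-invariant bounded measurable `Ψ` (Fubini + measure preservation);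
  ★★ `integral_integral_twist_eq` — hence `⟨Φ, K^tw Ψ⟩ = ⟨Φ, K Ψ⟩` for every `Φ` and invariant `Ψ`; ★ `integral_twist_eq` — equal rows (`Ψ ≡ 1`).
* §3 (group structure on `G`, `T` an action) ★ `twist_act_right` (`θ` right-invariant: `K^tw(x, T_h y) = K^tw(x, y)`), ★ `twist_act_left` (`θ` left-invariant and `K`
  DIAGONALLY invariant: `K^tw(T_h x, y) = K^tw(x, y)`) — the twist has exactly the slot-wise invariance R32 §1 proves for `K̃_β`; ★ `twist_symm` (`θ` inversion-invariant,
  `K` symmetric and diagonally invariant ⇒ `K^tw` symmetric); `twist_map_map` (a map `ι` commuting with the action and preserving `K` preserves `K^tw`: the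
  fibre-reflection parity of the model survives the twist).
HONEST FRAMING: abstract measure-theoretic identities for the rate twin of a registered stub of crux K1 of the CONDITIONAL reduction route `FlatTubeReduction` (R2b1 RECORD-label
femto rung; fixed lattice, `β → ∞`); no statement about the lattice kernel is made; `stub_boRate` is untouched; not infinite volume, not a mass gap, not Clay.
-/

set_option autoImplicit false

noncomputable section

open MeasureTheory

namespace Summit.QuantumFields.YangMills.Theorems.FemtoTransferGap.KernelTwist

open Summit.QuantumFields.YangMills.Theorems.FemtoTransferGap (integrable_of_measurable_abs_le)

variable {G X : Type*} [MeasurableSpace G] [MeasurableSpace X] {θ : Measure G} {μ : Measure X}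

/-! ## §1 Measurability and pointwise bounds of the twisted kernel -/

/-- The twisted kernel `(x, y) ↦ ∫ K(x, T_g y) dθ(g)` of a jointly measurable kernel along a jointly measurable family of maps is jointly measurable. [folklore] -/
theorem measurable_twist [SFinite θ] {K : X → X → ℝ} (hK : Measurable (Function.uncurry K)) {T : G → X → X}
    (hT : Measurable fun p : G × X => T p.1 p.2) :
    Measurable (Function.uncurry fun x y => ∫ g, K x (T g y) ∂θ) := by
  have h1 : Measurable fun q : (X × X) × G => (q.1.1, T q.2 q.1.2) :=
    (measurable_fst.comp measurable_fst).prodMk (hT.comp (measurable_snd.prodMk (measurable_snd.comp measurable_fst)))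
  have hf : Measurable fun q : (X × X) × G => K q.1.1 (T q.2 q.1.2) := hK.comp h1
  exact (hf.stronglyMeasurable.integral_prod_right' (ν := θ)).measurable

/-- For fixed `x`, `y ↦ ∫ K(x, T_g y) dθ(g)` is measurable. [folklore] -/
theorem measurable_twist_right [SFinite θ] {K : X → X → ℝ} (hK : Measurable (Function.uncurry K)) {T : G → X → X}
    (hT : Measurable fun p : G × X => T p.1 p.2) (x : X) :
    Measurable fun y => ∫ g, K x (T g y) ∂θ :=
  (measurable_twist hK hT).comp (measurable_const.prodMk measurable_id)

omit [MeasurableSpace X] in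
/-- The twist of a non-negative kernel is non-negative. [folklore] -/
theorem twist_nonneg {K : X → X → ℝ} (hK0 : ∀ x y, 0 ≤ K x y) (T : G → X → X) (x y : X) : 0 ≤ ∫ g, K x (T g y) ∂θ :=
  integral_nonneg fun g => hK0 x (T g y)

omit [MeasurableSpace X] in
/-- The twist of a non-negative kernel bounded by `M` is bounded by `M` (probability `θ`). [folklore] -/
theorem twist_le [IsProbabilityMeasure θ] {K : X → X → ℝ} (hK0 : ∀ x y, 0 ≤ K x y) {M : ℝ} (hKM : ∀ x y, K x y ≤ M) (T : G → X → X) (x y : X) :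
    ∫ g, K x (T g y) ∂θ ≤ M := by
  calc ∫ g, K x (T g y) ∂θ ≤ ∫ _g, M ∂θ :=
        integral_mono_of_nonneg (ae_of_all _ fun g => hK0 x (T g y)) (integrable_const M) (ae_of_all _ fun g => hKM x (T g y))
    _ = M := by rw [integral_const, probReal_univ, one_smul]

omit [MeasurableSpace X] in
/-- The twist of a kernel with `|K| ≤ M` satisfies `|K^tw| ≤ M` (probability `θ`). [folklore] -/
theorem abs_twist_le [IsProbabilityMeasure θ] {K : X → X → ℝ} {M : ℝ} (hKM : ∀ x y, |K x y| ≤ M) (T : G → X → X) (x y : X) :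
    |∫ g, K x (T g y) ∂θ| ≤ M := by
  calc |∫ g, K x (T g y) ∂θ| ≤ ∫ g, |K x (T g y)| ∂θ := abs_integral_le_integral_abs
    _ ≤ ∫ _g, M ∂θ := integral_mono_of_nonneg (ae_of_all _ fun g => abs_nonneg _) (integrable_const M) (ae_of_all _ fun g => hKM x (T g y))
    _ = M := by rw [integral_const, probReal_univ, one_smul]

/-! ## §2 ★★ Untwisting on invariant test functions -/

/-- ★★ **UNTWISTING**: against a `T`-invariant bounded measurable test function the twisted kernel integrates like the untwisted one —
`∫ (∫ K(x, T_g y) dθ(g)) Ψ(y) dμ(y) = ∫ K(x, y) Ψ(y) dμ(y)` (Fubini; `y ↦ T_g y` preserves `μ` and `Ψ`). [cite: SeilerLNP1982, §3] -/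
theorem integral_twist_mul_eq [IsProbabilityMeasure θ] [IsFiniteMeasure μ] {K : X → X → ℝ} (hK : Measurable (Function.uncurry K))
    {M : ℝ} (hKM : ∀ x y, |K x y| ≤ M) {T : G → X → X} (hT : Measurable fun p : G × X => T p.1 p.2)
    (hmp : ∀ g, MeasurePreserving (T g) μ μ) {Ψ : X → ℝ} (hΨ : Measurable Ψ) {CΨ : ℝ} (hΨb : ∀ y, |Ψ y| ≤ CΨ)
    (hinv : ∀ g y, Ψ (T g y) = Ψ y) (x : X) :
    ∫ y, (∫ g, K x (T g y) ∂θ) * Ψ y ∂μ = ∫ y, K x y * Ψ y ∂μ := by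
  have hKx : Measurable fun y => K x y := hK.comp (measurable_const.prodMk measurable_id)
  have hJ : Measurable fun p : G × X => K x (T p.1 p.2) * Ψ p.2 :=
    (hK.comp (measurable_const.prodMk hT)).mul (hΨ.comp measurable_snd)
  have hJb : ∀ p : G × X, |K x (T p.1 p.2) * Ψ p.2| ≤ M * CΨ := fun p => by
    rw [abs_mul]
    exact mul_le_mul (hKM _ _) (hΨb _) (abs_nonneg _) ((abs_nonneg _).trans (hKM x x))
  have hint : Integrable (fun p : G × X => K x (T p.1 p.2) * Ψ p.2) (θ.prod μ) := integrable_of_measurable_abs_le _ hJ hJb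
  have hstep : ∀ g, ∫ y, K x (T g y) * Ψ y ∂μ = ∫ y, K x y * Ψ y ∂μ := fun g => by
    have h := integral_map (μ := μ) (hmp g).measurable.aemeasurable (f := fun y => K x y * Ψ y) (hKx.mul hΨ).aestronglyMeasurable
    rw [(hmp g).map_eq] at h
    rw [h]
    exact integral_congr_ae (ae_of_all _ fun y => by simp only [hinv])
  calc ∫ y, (∫ g, K x (T g y) ∂θ) * Ψ y ∂μ
      = ∫ y, ∫ g, K x (T g y) * Ψ y ∂θ ∂μ := integral_congr_ae (ae_of_all _ fun y => (integral_mul_const (Ψ y) _).symm)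
    _ = ∫ g, ∫ y, K x (T g y) * Ψ y ∂μ ∂θ := (integral_integral_swap hint).symm
    _ = ∫ _g, ∫ y, K x y * Ψ y ∂μ ∂θ := integral_congr_ae (ae_of_all _ fun g => hstep g)
    _ = ∫ y, K x y * Ψ y ∂μ := by rw [integral_const, probReal_univ, one_smul]

/-- ★★ **THE FORMS OF THE TWISTED AND THE UNTWISTED KERNEL AGREE ON INVARIANT TEST FUNCTIONS**:
`∫∫ Φ(x) K^tw(x,y) Ψ(y) = ∫∫ Φ(x) K(x,y) Ψ(y)` for every `Φ` and every `T`-invariant bounded measurable `Ψ` — so every model-side estimate proved for `K`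
(`…FibredBO*`) is an estimate for `K^tw`. [cite: SeilerLNP1982, §3] [cite: Luscher1983, §3] -/
theorem integral_integral_twist_eq [IsProbabilityMeasure θ] [IsFiniteMeasure μ] {K : X → X → ℝ} (hK : Measurable (Function.uncurry K))
    {M : ℝ} (hKM : ∀ x y, |K x y| ≤ M) {T : G → X → X} (hT : Measurable fun p : G × X => T p.1 p.2)
    (hmp : ∀ g, MeasurePreserving (T g) μ μ) {Ψ : X → ℝ} (hΨ : Measurable Ψ) {CΨ : ℝ} (hΨb : ∀ y, |Ψ y| ≤ CΨ)
    (hinv : ∀ g y, Ψ (T g y) = Ψ y) (Φ : X → ℝ) :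
    ∫ x, ∫ y, Φ x * (∫ g, K x (T g y) ∂θ) * Ψ y ∂μ ∂μ = ∫ x, ∫ y, Φ x * K x y * Ψ y ∂μ ∂μ := by
  refine integral_congr_ae (ae_of_all _ fun x => ?_)
  dsimp only
  simp only [mul_assoc]
  rw [integral_const_mul, integral_const_mul, integral_twist_mul_eq hK hKM hT hmp hΨ hΨb hinv x]

/-- ★ **Equal rows**: `∫ K^tw(x,y) dμ(y) = ∫ K(x,y) dμ(y)` (the row bound `M₁` of `KernelParity` is the untwisted one). [folklore] -/
theorem integral_twist_eq [IsProbabilityMeasure θ] [IsFiniteMeasure μ] {K : X → X → ℝ} (hK : Measurable (Function.uncurry K))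
    {M : ℝ} (hKM : ∀ x y, |K x y| ≤ M) {T : G → X → X} (hT : Measurable fun p : G × X => T p.1 p.2)
    (hmp : ∀ g, MeasurePreserving (T g) μ μ) (x : X) :
    ∫ y, (∫ g, K x (T g y) ∂θ) ∂μ = ∫ y, K x y ∂μ := by
  have h := integral_twist_mul_eq (θ := θ) (μ := μ) hK hKM hT hmp (Ψ := fun _ => (1 : ℝ)) measurable_const (CΨ := 1) (fun _ => by simp)
    (fun _ _ => rfl) x
  simpa only [mul_one] using h

/-! ## §3 Slot-wise invariance and symmetry of the twist (group structure) -/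

section Group

variable [Group G] [MeasurableMul G]

omit [MeasurableSpace X] in
/-- ★ **Right-slot invariance**: for an action `T` and right-invariant `θ`, `K^tw(x, T_h y) = K^tw(x, y)`. [folklore] -/
theorem twist_act_right [θ.IsMulRightInvariant] (K : X → X → ℝ) {T : G → X → X} (hTmul : ∀ g h y, T (g * h) y = T g (T h y))
    (x y : X) (h : G) : ∫ g, K x (T g (T h y)) ∂θ = ∫ g, K x (T g y) ∂θ := by
  simp_rw [← hTmul]
  exact integral_mul_right_eq_self (fun g => K x (T g y)) h

omit [MeasurableSpace X] in
/-- ★ **Left-slot invariance**: for an action `T`, left-invariant `θ` and a DIAGONALLY invariant kernel (`K(T_g x, T_g y) = K(x,y)`), `K^tw(T_h x, y) = K^tw(x, y)` —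
together with `twist_act_right` this is the separate slot-wise invariance of `K̃_β = avgKernel` (R32 §1, `avgKernel_constLift_gaugeTransform`). [folklore] -/
theorem twist_act_left [θ.IsMulLeftInvariant] {K : X → X → ℝ} {T : G → X → X} (hTmul : ∀ g h y, T (g * h) y = T g (T h y))
    (hTone : ∀ y, T 1 y = y) (hdiag : ∀ g x y, K (T g x) (T g y) = K x y) (x y : X) (h : G) :
    ∫ g, K (T h x) (T g y) ∂θ = ∫ g, K x (T g y) ∂θ := by
  have hrw : ∀ g, K (T h x) (T g y) = K x (T (h⁻¹ * g) y) := fun g => by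
    rw [← hdiag h⁻¹ (T h x) (T g y), ← hTmul, ← hTmul, inv_mul_cancel, hTone]
  simp_rw [hrw]
  exact integral_mul_left_eq_self (fun g => K x (T g y)) h⁻¹

omit [MeasurableSpace X] [MeasurableMul G] in
/-- ★ **Symmetry**: for an action `T`, inversion-invariant `θ` and a symmetric diagonally invariant kernel, the twist is symmetric: `K^tw(y, x) = K^tw(x, y)`. [folklore] -/
theorem twist_symm [MeasurableInv G] [θ.IsInvInvariant] {K : X → X → ℝ} {T : G → X → X} (hTmul : ∀ g h y, T (g * h) y = T g (T h y))
    (hTone : ∀ y, T 1 y = y) (hdiag : ∀ g x y, K (T g x) (T g y) = K x y) (hsymm : ∀ x y, K x y = K y x) (x y : X) :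
    ∫ g, K y (T g x) ∂θ = ∫ g, K x (T g y) ∂θ := by
  have hrw : ∀ g, K y (T g x) = K x (T g⁻¹ y) := fun g => by
    rw [hsymm, ← hdiag g⁻¹ (T g x) y, ← hTmul, inv_mul_cancel, hTone]
  simp_rw [hrw]
  exact integral_inv_eq_self (fun g => K x (T g y)) θ

end Group

omit [MeasurableSpace X] in
/-- ★ **Parity survives the twist**: if a map `ι` of `X` (the fibre reflection `w ↦ −w`) commutes with every `T_g` and `K` is `ι ⊗ ι`-invariant, so is the twist:
`K^tw(ι x, ι y) = K^tw(x, y)` — the evenness hypothesis on the model kernel in `KernelParity.abs_form_sub_le_of_kernel_near_odd`. [folklore] -/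
theorem twist_map_map {K : X → X → ℝ} {T : G → X → X} (ι : X → X) (hcomm : ∀ g y, T g (ι y) = ι (T g y))
    (hK : ∀ x y, K (ι x) (ι y) = K x y) (x y : X) : ∫ g, K (ι x) (T g (ι y)) ∂θ = ∫ g, K x (T g y) ∂θ := by
  refine integral_congr_ae (ae_of_all _ fun g => ?_)
  dsimp only
  rw [hcomm, hK]

end Summit.QuantumFields.YangMills.Theorems.FemtoTransferGap.KernelTwist

end
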